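import Literature.AlgebraicGeometry.HodgeTheory.ThomGysinClosedImmersion
import Literature.AlgebraicGeometry.HodgeTheory.SupportedClassesRationalProofs
import Literature.AlgebraicGeometry.HodgeTheory.RationalClassesRingChange
import Literature.AlgebraicGeometry.Motives.MixedHodgeStructureOfPair
import Literature.AlgebraicGeometry.Motives.MixedHodgeStructureStrictProofs
import Literature.AlgebraicGeometry.Motives.SchemePairLongExactSequence
import Literature.AlgebraicGeometry.Motives.HodgeStructureSubstructures
import Mathlib.LinearAlgebra.TensorProduct.Pi
import Mathlib.RingTheory.TensorProduct.Free
import Mathlib.Algebra.Module.LinearMap.Rat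
import Mathlib.AlgebraicGeometry.IdealSheaf.Subscheme
import Mathlib.AlgebraicGeometry.Morphisms.ClosedImmersion
import HarnessLib

/-!
# Deligne's Cor. 8.2.8 (kernel of restriction = Gysin image of a resolution), reduced to
# Prop. 8.2.5 for the tree's mixed Hodge structures of pairs

Companion to `GysinKernel.lean` (the named fact
`Deligne1974_ker_restrictCompl_eq_iSup_range_complexGysin`: for `X` smooth projective of dimension
`n` over `ℂ`, a finite family `g j : Y j ⟶ X` from smooth projective `Y j`, `Z = ⋃ j, g_j(Y j)` and
every `b`, `ker (Hᵇ(X(ℂ); ℂ) → Hᵇ((X ∖ Z)(ℂ); ℂ)) = Σ_j im (g j)_*`; P. Deligne, *Théorie de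
Hodge III*, Publ. Math. IHÉS 44 (1974), Cor. 8.2.8), to `GysinKernelProofs.lean` (the inclusion `⊇`
unconditionally; `⊆` ⇔ its homological core) and to `ThomGysinClosedImmersion.lean` (`⊆` from
Prop. 8.2.7 in Čech form, `Deligne1974_ker_restrictCompl_eq_iSup_range_complexGysin_of_pullback`;
the closed-immersion case unconditionally). Those files isolate as the whole residual content of
the discharge Deligne's Prop. 8.2.7 for a SINGULAR `Z`, i.e. mixed Hodge theory. This file carries
the reduction to its end INSIDE the tree's mixed-Hodge vocabulary
(`Motives/MixedHodgeStructure`, `Motives/MixedHodgeStructureOfPair`): it proves the named fact from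

* a package `M : Motives.MixedHodgeStructureOfPair ℂ` of mixed Hodge structures on the rational
  cohomology of pairs of `ℂ`-varieties (functorial; `Hⁿ` of a smooth projective variety pure of
  weight `n`) — the content of the named fact `MixedHodgeStructureOfPair.existsDeligne`
  (Hodge III, 8.2.2, 8.3.8–8.3.9; unproved, XL: it is Hodge II–III);
* Deligne's **Prop. 8.2.5** for that package (hypothesis `h825`) — source read, NUMDAM PDF p. 36
  (= printed p. 39), verbatim: "**Proposition (8.2.5).** — Supposons `X` propre. Si `π : Y → X` est
  un morphisme propre surjectif, avec `Y` lisse, alors le quotient de poids `n` de `Hⁿ(X, ℚ)` est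
  l'image de `Hⁿ(X, ℚ)` dans `Hⁿ(Y, ℚ)`", i.e. (with Thm. 8.2.4 (iii): "Si `X` est propre, alors
  `p + q ≤ n`", so that `W_n Hⁿ(X) = Hⁿ(X)`) `Ker(π^* : Hⁿ(X, ℚ) → Hⁿ(Y, ℚ)) = W_{n-1} Hⁿ(X, ℚ)`.
  Here `Y = ⊔_j Y_j` is a finite disjoint union of smooth projective varieties and only the
  inclusion `Ker ⊆ W_{n-1}` is assumed. This statement is NOT among the axioms of
  `MixedHodgeStructureOfPair` (its printed proof is the exact sequence (8.2.5.2)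
  `0 → Hⁿ(X)/W_{n-1} → Hⁿ(Y₀) → Hⁿ(Y₁)` of a proper hypercovering `Y_•` with `Y₀ = Y`, a property
  of Deligne's CONSTRUCTION), and it is deliberately not vendored as a named fact (D-0026): it is
  a hypothesis of the theorems below, to be supplied together with `existsDeligne`;
* the **local contractibility of complex algebraic sets** (hypothesis `hLC`:
  `{P ∈ X(ℂ) | pt P ∈ S}` is locally contractible for `S ⊆ X` Zariski-closed, `X` smooth
  projective; Łojasiewicz 1964 / triangulability — absent from the tree, cf.
  `HodgeSectionRestrictionProofs`), needed to pass from the singular cohomology of `Z(ℂ)`, on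
  which `M` lives, to the germ of `Z(ℂ)` in `X(ℂ)` (tautness, Spanier Ch. 6 §1 Thm. 10).

The proof is the printed one. Prop. 8.2.7 (PDF p. 37 = printed p. 40: "Soient `X̃ →π X →f Y`. On
suppose que `Y` est lisse, que `X` est propre, que `X̃` est propre et lisse et que `π` est
surjectif. Alors, les noyaux de `f^*` et de `(fπ)^*` dans `Hⁱ(Y, ℚ)` sont égaux. […] c) Pour
`i = n`, ces noyaux sont égaux car `Gr^W_n(π^*)` est injectif (8.2.5.2)") is applied with
`Y := X` (smooth projective, `Hⁱ` pure of weight `i`: `M.isPure`), `X := Z` the closed subscheme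
of `X` carried by `⋃ j, g_j(Y j)` (`exists_closedSubscheme_factor`: the subscheme of the product
of the kernel ideal sheaves of the proper `g j`, Mathlib `Scheme.Hom.ker`, `IdealSheafData.subscheme`,
through which every `g j` factors as `π j ≫ i`) and `X̃ := ⊔ Y j`: a class `v ∈ Hⁱ(X(ℂ); ℚ)` with
`(g j)(ℂ)^* v = 0` for all `j` has `i^* v ∈ W_{i-1} Hⁱ(Z) ∩ i^*(Hⁱ(X)) = i^*(W_{i-1} Hⁱ(X)) = 0` by
8.2.5 and strictness (Hodge II Thm. 2.3.5 (iii), PROVED in the tree: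
`MixedHodgeStructure.Hom.map_W_eq`) — `singularCohomology_map_rat_eq_zero_of_W`. Tensoring with
`ℂ` (`complexBetti_map_eq_zero_of_rat`: rational classes span `Hⁱ(X(ℂ); ℂ)`, the tree's
`span_isRationalClass_eq_top_of_isSmoothProjective_holds`; `Hⁱ(–; ℚ) ⊗ ℂ ↪ Hⁱ(–; ℂ)` for the `Y j`,
`injective_liftBaseChange_ringChange`; and flatness of `ℂ/ℚ`,
`mem_span_image_iInf_ker_of_forall_apply_eq_zero`) gives `i(ℂ)^* x' = 0` for every complex class
`x'` killed by the `(g j)(ℂ)^*`; tautness of `Z(ℂ) ≅ {P | pt P ∈ Z}` in `X(ℂ)` (`hLC`) upgrades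
this to vanishing on an open neighbourhood
(`exists_isOpen_map_subsetIncl_eq_zero_of_complexBetti_map_eq_zero`), which is the hypothesis of
`Deligne1974_ker_restrictCompl_eq_iSup_range_complexGysin_of_pullback` (Deligne's "(8.2.8.1) est la
suite transposée de (8.2.8.2) par dualité de Poincaré", proved in `ThomGysinClosedImmersion` /
`AlgebraicTopology/SingularHomology/GysinTransposition`).

Main result: `Deligne1974_ker_restrictCompl_eq_iSup_range_complexGysin_of_mixedHodgeStructure`.
Everything in this file is a theorem (no definitions, no named facts); the named fact itself is
NOT discharged — what remains is exactly `existsDeligne` (with 8.2.5 for the package it provides)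
and the local contractibility of complex algebraic sets.

## References

* [DeligneHodgeIII1974] P. Deligne, Théorie de Hodge III, Publ. Math. IHÉS 44 (1974), Thm. 8.2.4,
  Prop. 8.2.5, Prop. 8.2.7, Cor. 8.2.8 (pp. 38–40; NUMDAM PDF pp. 35–37).
* [DeligneHodgeII1971] P. Deligne, Théorie de Hodge II, Publ. Math. IHÉS 40 (1971), Thm. 2.3.5 (iii).
* [VoisinHodgeI2002] C. Voisin, Hodge Theory and Complex Algebraic Geometry I, CUP 2002, §7.1.1
  (`Hᵏ(X, ℂ) = Hᵏ(X, ℚ) ⊗ ℂ`).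
* [HatcherAT2002] A. Hatcher, Algebraic Topology, CUP 2002, §3.1 pp. 198–200.
* [Spanier1981] E. H. Spanier, Algebraic Topology, Springer 1981, Ch. 6 §1 Thm. 10.
* [Hartshorne1977] R. Hartshorne, Algebraic Geometry, Springer 1977, II Cor. 4.8, Ex. 3.11 (d).
-/

noncomputable section

open CategoryTheory AlgebraicGeometry
open scoped TensorProduct
open Literature.AlgebraicTopology.SingularHomology

namespace Literature.AlgebraicGeometry.HodgeTheory

section HodgeTheory

/-! ### (P1) Purity and strictness: the algebraic heart of Prop. 8.2.7 -/

section MHS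

open Literature.AlgebraicGeometry.Motives

universe u v

variable {V : Type u} [AddCommGroup V] [Module ℚ V] {V' : Type v} [AddCommGroup V'] [Module ℚ V']

/-- **Purity + strictness.** A morphism of mixed Hodge structures `f : H₁ → H₂` with `H₁` pure of
weight `n` kills every `x` with `f x ∈ W_k H₂`, `k < n`: by strictness (Deligne, Hodge II,
Thm. 2.3.5 (iii), the tree's `MixedHodgeStructure.Hom.map_W_eq`) `W_k H₂ ∩ im f = f(W_k H₁) = f(0)`.
This is steps a)–c) of the printed proof of Hodge III Prop. 8.2.7 once `f x ∈ W_{n-1}` is known.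
[cite: DeligneHodgeIII1974, Prop. 8.2.7 (proof)] [cite: DeligneHodgeII1971, Thm. 2.3.5 (iii)] -/
theorem mhsHom_apply_eq_zero_of_isPure_of_mem_W {H₁ : MixedHodgeStructure V}
    {H₂ : MixedHodgeStructure V'} (f : MixedHodgeStructure.Hom H₁ H₂) {n k : ℤ}
    (hn : H₁.IsPure n) (hk : k < n) {x : V} (hx : f.toLinearMap x ∈ H₂.W k) :
    f.toLinearMap x = 0 := by
  have h : f.toLinearMap x ∈ H₂.W k ⊓ LinearMap.range f.toLinearMap := ⟨hx, x, rfl⟩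
  rw [← f.map_W_eq k, hn.1 k hk, Submodule.map_bot] at h
  exact (Submodule.mem_bot ℚ).1 h

end MHS

/-! ### (P2) Rational structures: complex solutions of rational linear constraints -/

section LinearAlgebra

universe u v w w'

variable {V : Type u} [AddCommGroup V] [Module ℚ V]
  {V' : Type v} [AddCommGroup V'] [Module ℂ V'] [Module ℚ V'] [IsScalarTower ℚ ℂ V']

/-- A `ℚ`-linear map `i : V → V'` into a complex vector space which sends some `ℚ`-basis to a
`ℂ`-linearly independent family has injective complexification `ℂ ⊗_ℚ V → V'`. [folklore] -/
theorem injective_liftBaseChange_of_basis {κ : Type w} (b : Module.Basis κ ℚ V) (i : V →ₗ[ℚ] V')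
    (h : LinearIndependent ℂ (fun a ↦ i (b a))) : Function.Injective (i.liftBaseChange ℂ) := by
  set B := Algebra.TensorProduct.basis ℂ b with hB
  rw [← LinearMap.ker_eq_bot, Submodule.eq_bot_iff]
  intro t ht
  have hrepr : Finsupp.linearCombination ℂ B (B.repr t) = t := B.linearCombination_repr t
  have hcomp : (fun a ↦ i (b a)) = (i.liftBaseChange ℂ) ∘ B := by
    funext a
    simp only [Function.comp_apply, hB, Algebra.TensorProduct.basis_apply,
      LinearMap.liftBaseChange_tmul, one_smul]
  have h0 : Finsupp.linearCombination ℂ (fun a ↦ i (b a)) (B.repr t) = 0 := by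
    rw [hcomp, ← Finsupp.apply_linearCombination, hrepr]
    exact ht
  have hz : B.repr t = 0 := linearIndependent_iff.mp h _ h0
  rw [← hrepr, hz, map_zero]

variable {ι : Type w} [Fintype ι] [DecidableEq ι]
  {W : ι → Type w'} [∀ j, AddCommGroup (W j)] [∀ j, Module ℚ (W j)]
  {W' : ι → Type w'} [∀ j, AddCommGroup (W' j)] [∀ j, Module ℂ (W' j)] [∀ j, Module ℚ (W' j)]
  [∀ j, IsScalarTower ℚ ℂ (W' j)]

/-- **Complex solutions of rational linear constraints are spanned by rational solutions.** Let
`i_V : V → V'`, `i_j : W_j → W'_j` be `ℚ`-linear maps into complex vector spaces, the `i_j` with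
injective complexification (`ℂ ⊗_ℚ W_j ↪ W'_j`), and `f_j : V → W_j`, `f'_j : V' → W'_j` compatible
(`f'_j ∘ i_V = i_j ∘ f_j`, `j` in a finite set). Then every `x' ∈ ℂ · i_V(V)` killed by all `f'_j`
lies in `ℂ · i_V(⋂_j ker f_j)` (flatness of `ℂ/ℚ`: `(ker f)_ℂ = ker f_ℂ`, the tree's
`HodgeStructure.mem_baseChange_ker_iff`, for `f = (f_j)_j : V → Π_j W_j`). [folklore] -/
theorem mem_span_image_iInf_ker_of_forall_apply_eq_zero (iV : V →ₗ[ℚ] V')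
    (iW : ∀ j, W j →ₗ[ℚ] W' j) (hW : ∀ j, Function.Injective ((iW j).liftBaseChange ℂ))
    (f : ∀ j, V →ₗ[ℚ] W j) (f' : ∀ j, V' →ₗ[ℂ] W' j) (hf : ∀ j v, f' j (iV v) = iW j (f j v))
    {x' : V'} (hx' : x' ∈ Submodule.span ℂ (Set.range iV)) (h0 : ∀ j, f' j x' = 0) :
    x' ∈ Submodule.span ℂ (iV '' ↑(⨅ j, LinearMap.ker (f j))) := by
  have hx'' : x' ∈ LinearMap.range (iV.liftBaseChange ℂ) := by
    rw [LinearMap.range_liftBaseChange, LinearMap.coe_range]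
    exact hx'
  obtain ⟨t, rfl⟩ := hx''
  set F : V →ₗ[ℚ] (∀ j, W j) := LinearMap.pi f with hF
  -- the compatibility square, complexified: `Ψ_j ∘ pr_j ∘ F_ℂ = f'_j ∘ Φ`
  have key : ∀ (j : ι) (s : ℂ ⊗[ℚ] V),
      (iW j).liftBaseChange ℂ (TensorProduct.piRight ℚ ℂ ℂ W (F.baseChange ℂ s) j) =
        f' j (iV.liftBaseChange ℂ s) := by
    intro j s
    induction s using TensorProduct.induction_on with
    | zero => simp only [map_zero, Pi.zero_apply]
    | tmul c v =>
      rw [LinearMap.baseChange_tmul, TensorProduct.piRight_apply, TensorProduct.piRightHom_tmul,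
        LinearMap.liftBaseChange_tmul, LinearMap.liftBaseChange_tmul, hF, LinearMap.pi_apply,
        LinearMap.map_smul_of_tower, hf]
    | add s₁ s₂ h₁ h₂ => simp only [map_add, Pi.add_apply, h₁, h₂]
  have hFt : F.baseChange ℂ t = 0 := by
    apply (TensorProduct.piRight ℚ ℂ ℂ W).injective
    rw [map_zero]
    funext j
    apply hW j
    rw [Pi.zero_apply, map_zero, key, h0]
  have ht : t ∈ (LinearMap.ker F).baseChange ℂ :=
    (Motives.HodgeStructure.mem_baseChange_ker_iff F t).2 hFt
  rw [hF, LinearMap.ker_pi] at ht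
  have hle : Submodule.map (iV.liftBaseChange ℂ) ((⨅ j, LinearMap.ker (f j)).baseChange ℂ) ≤
      Submodule.span ℂ (iV '' ↑(⨅ j, LinearMap.ker (f j))) := by
    rw [Submodule.baseChange_eq_span, Submodule.map_span, Submodule.span_le]
    rintro _ ⟨_, ⟨v, hv, rfl⟩, rfl⟩
    refine Submodule.subset_span ⟨v, hv, ?_⟩
    rw [TensorProduct.mk_apply, LinearMap.liftBaseChange_tmul, one_smul]
  exact hle ⟨t, ht, rfl⟩

end LinearAlgebra

/-! ### (P3) The rational structure `Hᵏ(T; ℚ) → Hᵏ(T; ℂ)` of singular cohomology -/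

section Cohomology

universe u

variable {T S : Type u} [TopologicalSpace T] [TopologicalSpace S] {k : ℕ}

/-- **Change of coefficients `ℚ → ℂ` commutes with pull-backs**: for `g : T → S` continuous,
`ι_T (g^* x) = g^* (ι_S x)` (both are `u ↦ (ℚ ↪ ℂ) ∘ u ∘ g_♯` on cochains; Hatcher 2002, §3.1
p. 198). [cite: HatcherAT2002, §3.1 p. 198] -/
theorem ringChange_map (g : C(T, S)) (x : singularCohomology ℚ ℚ S k) :
    singularCohomology.ringChange (algebraMap ℚ ℂ) T k (singularCohomology.map ℚ ℚ g k x) =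
      singularCohomology.map ℂ ℂ g k (singularCohomology.ringChange (algebraMap ℚ ℂ) S k x) := by
  induction x using singularCohomology_induction_on with
  | h u =>
    rw [singularCohomology.map_π, singularCohomology.ringChange_π, singularCohomology.ringChange_π,
      singularCohomology.map_π]
    congr 1
    refine coFn_injective ?_
    rw [coFn_cocyclesRingChange, coFn_cocyclesMap, coFn_cocyclesMap, coFn_cocyclesRingChange]
    funext σ
    rfl

variable (T k) in
/-- **`Hᵏ(T; ℚ) ⊗_ℚ ℂ → Hᵏ(T; ℂ)` is injective** for every space `T` (the complexification of the
`ℚ`-linear map `ι_T = ringChange (ℚ ↪ ℂ)`, for any `ℚ`-module structure on `Hᵏ(T; ℂ)` compatible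
with the complex one): a `ℚ`-basis of `Hᵏ(T; ℚ)` stays `ℂ`-independent (the tree's
`linearIndependent_ringChange_iff`, Voisin I §7.1.1). [cite: VoisinHodgeI2002, §7.1.1] -/
theorem injective_liftBaseChange_ringChange [Module ℚ (singularCohomology ℂ ℂ T k)]
    [IsScalarTower ℚ ℂ (singularCohomology ℂ ℂ T k)] :
    Function.Injective
      ((singularCohomology.ringChange (algebraMap ℚ ℂ) T k).toRatLinearMap.liftBaseChange ℂ) := by
  set b := Module.Basis.ofVectorSpace ℚ (singularCohomology ℚ ℚ T k)
  exact injective_liftBaseChange_of_basis b _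
    ((linearIndependent_ringChange_iff (Y := T) (k := k) b).2 b.linearIndependent)

end Cohomology

/-! ### (P4) The closed subscheme `Z ⊆ X` carried by the joint image of the family -/

section Subscheme

open Literature.AlgebraicGeometry.Motives

variable {n : ℕ} {X : Motives.SchemeOver ℂ}

/-- The support of a finite product of ideal sheaves is the union of the supports. [folklore] -/
theorem coe_support_finset_prod {Y : Scheme} {ι : Type*} (I : ι → Y.IdealSheafData)
    (s : Finset ι) :
    ((∏ j ∈ s, I j).support : Set Y) = ⋃ j ∈ s, ((I j).support : Set Y) := by
  classical
  induction s using Finset.induction_on with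
  | empty =>
    rw [Finset.prod_empty, Scheme.IdealSheafData.one_eq_top, Scheme.IdealSheafData.support_top]
    simp
  | insert a s ha ih =>
    rw [Finset.prod_insert ha, Scheme.IdealSheafData.support_mul, TopologicalSpace.Closeds.coe_sup,
      ih, Finset.set_biUnion_insert]

/-- A finite product of ideal sheaves is contained in each factor. [folklore] -/
theorem finset_prod_le {Y : Scheme} {ι : Type*} (I : ι → Y.IdealSheafData) {s : Finset ι} {j : ι}
    (hj : j ∈ s) : ∏ i ∈ s, I i ≤ I j := by
  classical
  rw [← Finset.mul_prod_erase s I hj]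
  calc I j * ∏ i ∈ s.erase j, I i ≤ I j * 1 :=
        mul_le_mul_of_nonneg_left (Scheme.IdealSheafData.one_eq_top (X := Y) ▸ le_top) bot_le
    _ = I j := mul_one _

/-- **The closed subscheme through which a finite family of proper morphisms factors.** For
`X` smooth projective and `g j : Y j ⟶ X` a finite family of morphisms from smooth projective
varieties, there is a closed subscheme `i : Z ↪ X` with underlying set the joint image
`⋃ j, g_j(Y j)` (the subscheme of the product of the kernel ideal sheaves of the `g j`, whose
supports are the closed images, Mathlib `Scheme.Hom.support_ker`) through which every `g j`
factors (`Scheme.Hom.toImage` followed by the inclusion of subschemes).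
[cite: Hartshorne1977, II Ex. 3.11 (d)] -/
theorem exists_closedSubscheme_factor (hX : IsSmoothProjective n X) {ι : Type} [Finite ι]
    {m : ι → ℕ} {Y : ι → Motives.SchemeOver ℂ} (hY : ∀ j, IsSmoothProjective (m j) (Y j))
    (g : ∀ j, Y j ⟶ X) :
    ∃ (Z : Motives.SchemeOver ℂ) (i : Z ⟶ X) (_ : IsClosedImmersion i.left) (π : ∀ j, Y j ⟶ Z),
      (∀ j, π j ≫ i = g j) ∧ Set.range i.left.base = ⋃ j, Set.range (g j).left.base := by
  classical
  haveI := Fintype.ofFinite ι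
  haveI : ∀ j, IsProper (g j).left := fun j ↦ isProper_left_of_isSmoothProjective (hY j) hX (g j)
  let I : X.left.IdealSheafData := ∏ j, (g j).left.ker
  have hle : ∀ j, I ≤ (g j).left.ker := fun j ↦ finset_prod_le _ (Finset.mem_univ j)
  have hsupp : (I.support : Set X.left) = ⋃ j, Set.range (g j).left.base := by
    have h1 : ∀ j, (((g j).left.ker.support : Set X.left)) = Set.range (g j).left.base := fun j ↦ by
      rw [Scheme.Hom.support_ker, (Scheme.Hom.isClosedMap (g j).left).isClosed_range.closure_eq]
    change (((∏ j ∈ Finset.univ, (g j).left.ker).support : Set X.left)) = _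
    rw [coe_support_finset_prod]
    simp only [Finset.mem_univ, Set.iUnion_true, h1]
  refine ⟨Over.mk (I.subschemeι ≫ X.hom), Over.homMk I.subschemeι rfl,
    inferInstanceAs (IsClosedImmersion I.subschemeι),
    fun j ↦ Over.homMk ((g j).left.toImage ≫ Scheme.IdealSheafData.inclusion (hle j)) ?_,
    fun j ↦ ?_, ?_⟩
  · change ((g j).left.toImage ≫ Scheme.IdealSheafData.inclusion (hle j)) ≫ I.subschemeι ≫ X.hom =
      (Y j).hom
    rw [Category.assoc, Scheme.IdealSheafData.inclusion_subschemeι_assoc,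
      Scheme.Hom.toImage_imageι_assoc, Over.w (g j)]
  · ext : 1
    change ((g j).left.toImage ≫ Scheme.IdealSheafData.inclusion (hle j)) ≫ I.subschemeι =
      (g j).left
    rw [Category.assoc, Scheme.IdealSheafData.inclusion_subschemeι, Scheme.Hom.toImage_imageι]
  · change Set.range I.subschemeι.base = _
    rw [← hsupp]
    exact Scheme.IdealSheafData.range_subschemeι I

end Subscheme

/-! ### (P5) Assembly: Prop. 8.2.7 in Čech form from the MHS package, Prop. 8.2.5 and tautness -/

section Assembly

open Literature.AlgebraicGeometry.Motives

variable {n : ℕ} {X : Motives.SchemeOver ℂ}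

/-- A closed subscheme `Z ↪ X` of a smooth projective variety is a variety (separated, of finite
type) and is proper over `ℂ` (closed immersions are proper; Hartshorne II Cor. 4.8).
[cite: Hartshorne1977, Ch. II Cor. 4.8] -/
theorem isVarietyPair_and_isProper_of_isClosedImmersion (hX : IsSmoothProjective n X)
    {Z : Motives.SchemeOver ℂ} (i : Z ⟶ X) [IsClosedImmersion i.left] :
    (SchemePair.ofScheme Z).IsVarietyPair ∧ IsProper Z.hom := by
  haveI : IsProper X.hom := IsSmoothProjective.isProper_holds hX
  have h : Z.hom = i.left ≫ X.hom := (Over.w i).symm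
  refine ⟨⟨?_, ?_, ?_⟩, ?_⟩
  · change IsSeparated Z.hom
    rw [h]; infer_instance
  · change LocallyOfFiniteType Z.hom
    rw [h]; infer_instance
  · change QuasiCompact Z.hom
    rw [h]; infer_instance
  · rw [h]; infer_instance

/-- Naturality of `Hⁿ((X, ∅)) ≅ Hⁿ(X(ℂ); ℚ)` (`SchemePair.absIso`) in the scheme: pull-back of pairs
`(A, ∅) → (B, ∅)` along `φ : A ⟶ B` is pull-back along `φ(ℂ)` on absolute cohomology
(`relSingularCohomology.map_comp_toAbsolute`). [cite: HatcherAT2002, §3.1 p. 200] -/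
theorem absIso_hom_map_ofScheme {A B : Motives.SchemeOver ℂ} (φ : A ⟶ B) (q : ℕ)
    (w : (SchemePair.ofScheme B).bettiCohomology q) :
    (SchemePair.absIso A q).hom (SchemePair.bettiCohomology.map (SchemePair.Hom.ofScheme φ) q w) =
      singularCohomology.map ℚ ℚ (AlgPoints.mapContinuous (L := ℂ) φ) q
        ((SchemePair.absIso B q).hom w) := by
  have h := relSingularCohomology.map_comp_toAbsolute (R := ℚ) (M := ℚ)
    (AlgPoints.mapContinuous (L := ℂ) (SchemePair.Hom.ofScheme φ).fX)
    (SchemePair.Hom.mapsTo_pointsSub_mapContinuous (SchemePair.Hom.ofScheme φ)) q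
  rw [SchemePair.absIso_hom, SchemePair.absIso_hom, ← ModuleCat.comp_apply, ← ModuleCat.comp_apply]
  exact LinearMap.congr_fun (congrArg ModuleCat.Hom.hom h) w

/-- **Prop. 8.2.7 over `ℚ`, from the mixed Hodge structures of pairs and Prop. 8.2.5.** Let `X` be
smooth projective, `g j : Y j ⟶ X` a finite family from smooth projective varieties factoring as
`g j = π j ≫ i` through a closed subscheme `i : Z ↪ X`, and `M` a package of mixed Hodge structures
on the cohomology of pairs (`Motives.MixedHodgeStructureOfPair ℂ`). IF the classes of
`H^q((Z, ∅)) = H^q(Z(ℂ); ℚ)` killed by all `(π j)^*` lie in `W_{q-1}` (Deligne, Hodge III,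
Prop. 8.2.5 for the package: "le quotient de poids `n` de `Hⁿ(X, ℚ)` est l'image de `Hⁿ(X, ℚ)`
dans `Hⁿ(Y, ℚ)`", hypothesis `h825Z`), THEN every `v ∈ H^q(X(ℂ); ℚ)` killed by all `(g j)(ℂ)^*`
is killed by `i(ℂ)^*` — the printed proof: `i^* v ∈ W_{q-1} ∩ i^*(H^q(X))`, `H^q(X)` pure of
weight `q` (`M.isPure`), so `i^* v = 0` by strictness (`mhsHom_apply_eq_zero_of_isPure_of_mem_W`).
[cite: DeligneHodgeIII1974, Prop. 8.2.7 (proof) and Prop. 8.2.5] -/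
theorem singularCohomology_map_rat_eq_zero_of_W (M : MixedHodgeStructureOfPair ℂ)
    (hX : IsSmoothProjective n X) {ι : Type} {Y : ι → Motives.SchemeOver ℂ} (g : ∀ j, Y j ⟶ X)
    {Z : Motives.SchemeOver ℂ} (i : Z ⟶ X) [IsClosedImmersion i.left] (π : ∀ j, Y j ⟶ Z)
    (hπ : ∀ j, π j ≫ i = g j) (q : ℕ)
    (h825Z : ∀ y : (SchemePair.ofScheme Z).bettiCohomology q,
      (∀ j, SchemePair.bettiCohomology.map (SchemePair.Hom.ofScheme (π j)) q y = 0) →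
        y ∈ (M.mhs (SchemePair.ofScheme Z) q).W ((q : ℤ) - 1))
    (v : singularCohomology ℚ ℚ (ComplexPoints X) q)
    (hv : ∀ j, singularCohomology.map ℚ ℚ (AlgPoints.mapContinuous (L := ℂ) (g j)) q v = 0) :
    singularCohomology.map ℚ ℚ (AlgPoints.mapContinuous (L := ℂ) i) q v = 0 := by
  have hXv := IsSmoothProjective.isVarietyPair_ofScheme_holds hX
  have hZv := (isVarietyPair_and_isProper_of_isClosedImmersion hX i).1
  set vv := (SchemePair.absIso X q).inv v with hvv
  have hv' : (SchemePair.absIso X q).hom vv = v := by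
    rw [hvv, ← ModuleCat.comp_apply, Iso.inv_hom_id, ModuleCat.id_apply]
  set y := SchemePair.bettiCohomology.map (SchemePair.Hom.ofScheme i) q vv with hy
  -- `(π j)^* y = (g j)^* vv = 0`
  have hyj : ∀ j, SchemePair.bettiCohomology.map (SchemePair.Hom.ofScheme (π j)) q y = 0 := by
    intro j
    have hc : SchemePair.Hom.ofScheme (π j) ≫ SchemePair.Hom.ofScheme i =
        SchemePair.Hom.ofScheme (g j) := by
      rw [← hπ j]
      exact (SchemePair.hom_ext rfl (Category.id_comp _).symm).symm
    have e1 : SchemePair.bettiCohomology.map (SchemePair.Hom.ofScheme (π j)) q y =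
        SchemePair.bettiCohomology.map (SchemePair.Hom.ofScheme (g j)) q vv := by
      rw [hy, ← ModuleCat.comp_apply, ← SchemePair.bettiCohomology.map_comp, hc]
    apply (ConcreteCategory.bijective_of_isIso (SchemePair.absIso (Y j) q).hom).1
    rw [map_zero, e1, absIso_hom_map_ofScheme, hv', hv]
  -- `y ∈ W_{q-1}`, hence `y = 0` by purity of `H^q(X)` and strictness
  have hy0 : y = 0 := by
    have hφ := M.mapHom_toLinearMap hZv hXv (SchemePair.Hom.ofScheme i) q
    have key := mhsHom_apply_eq_zero_of_isPure_of_mem_W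
      (M.mapHom hZv hXv (SchemePair.Hom.ofScheme i) q) (M.isPure hX q)
      (show (q : ℤ) - 1 < q by omega) (x := vv) (by rw [hφ]; exact h825Z y hyj)
    rw [hφ] at key
    exact key
  have h := absIso_hom_map_ofScheme i q vv
  rw [← hy, hy0, map_zero, hv'] at h
  exact h.symm

/-- **From `ℚ` to `ℂ`.** If every rational class `v ∈ H^q(X(ℂ); ℚ)` killed by all `(g j)(ℂ)^*` is
killed by `i(ℂ)^*`, the same holds for complex classes `x' ∈ H^q(X(ℂ); ℂ)`: the rational classes
span `H^q(X(ℂ); ℂ)` for `X` smooth projective (the tree's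
`span_isRationalClass_eq_top_of_isSmoothProjective_holds`), `H^q(Y j(ℂ); ℚ) ⊗ ℂ ↪ H^q(Y j(ℂ); ℂ)`
(`injective_liftBaseChange_ringChange`), and complex solutions of the rational constraints
`(g j)^* = 0` are spanned by rational ones (`mem_span_image_iInf_ker_of_forall_apply_eq_zero`).
This is the passage "`Hᵏ(–, ℂ) = Hᵏ(–, ℚ) ⊗ ℂ`" between Deligne's rational statement and the
tree's complex carriers. [cite: VoisinHodgeI2002, §7.1.1] [cite: DeligneHodgeIII1974, Cor. 8.2.8] -/
theorem complexBetti_map_eq_zero_of_rat (hX : IsSmoothProjective n X) {ι : Type} [Finite ι]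
    {Y : ι → Motives.SchemeOver ℂ} (g : ∀ j, Y j ⟶ X) {Z : Motives.SchemeOver ℂ} (i : Z ⟶ X)
    (q : ℕ)
    (hQ : ∀ v : singularCohomology ℚ ℚ (ComplexPoints X) q,
      (∀ j, singularCohomology.map ℚ ℚ (AlgPoints.mapContinuous (L := ℂ) (g j)) q v = 0) →
        singularCohomology.map ℚ ℚ (AlgPoints.mapContinuous (L := ℂ) i) q v = 0)
    (x' : complexBetti X q) (hx' : ∀ j, complexBetti.map (g j) q x' = 0) :
    complexBetti.map i q x' = 0 := by
  classical
  haveI := Fintype.ofFinite ι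
  letI mX : Module ℚ (complexBetti X q) := Module.compHom _ (algebraMap ℚ ℂ)
  haveI tX : IsScalarTower ℚ ℂ (complexBetti X q) := ⟨fun a b x ↦ by
    change (a • b) • x = algebraMap ℚ ℂ a • (b • x)
    rw [Algebra.smul_def, mul_smul]⟩
  letI mY : ∀ j, Module ℚ (complexBetti (Y j) q) := fun j ↦ Module.compHom _ (algebraMap ℚ ℂ)
  haveI tY : ∀ j, IsScalarTower ℚ ℂ (complexBetti (Y j) q) := fun j ↦ ⟨fun a b x ↦ by
    change (a • b) • x = algebraMap ℚ ℂ a • (b • x)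
    rw [Algebra.smul_def, mul_smul]⟩
  set iV := (singularCohomology.ringChange (algebraMap ℚ ℂ) (ComplexPoints X) q).toRatLinearMap
    with hiV
  have hspan : x' ∈ Submodule.span ℂ (Set.range iV) := by
    have h := span_isRationalClass_eq_top_of_isSmoothProjective_holds n X hX q
    rw [setOf_isRationalClass_eq_range] at h
    have e : Set.range iV =
        Set.range (singularCohomology.ringChange (algebraMap ℚ ℂ) (ComplexPoints X) q) := rfl
    rw [e, h]
    exact Submodule.mem_top
  have key := mem_span_image_iInf_ker_of_forall_apply_eq_zero (ι := ι)
    (W := fun j ↦ singularCohomology ℚ ℚ (ComplexPoints (Y j)) q) (W' := fun j ↦ complexBetti (Y j) q)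
    iV (fun j ↦ (singularCohomology.ringChange (algebraMap ℚ ℂ) (ComplexPoints (Y j)) q).toRatLinearMap)
    (fun j ↦ injective_liftBaseChange_ringChange (ComplexPoints (Y j)) q)
    (fun j ↦ (singularCohomology.map ℚ ℚ (AlgPoints.mapContinuous (L := ℂ) (g j)) q).hom)
    (fun j ↦ (complexBetti.map (g j) q).hom)
    (fun j v ↦ (ringChange_map (AlgPoints.mapContinuous (L := ℂ) (g j)) v).symm) hspan hx'
  have hle : Submodule.span ℂ (iV '' ↑(⨅ j, LinearMap.ker
      (singularCohomology.map ℚ ℚ (AlgPoints.mapContinuous (L := ℂ) (g j)) q).hom)) ≤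
      LinearMap.ker (complexBetti.map i q).hom := by
    rw [Submodule.span_le]
    rintro _ ⟨v, hv, rfl⟩
    rw [SetLike.mem_coe, LinearMap.mem_ker]
    change complexBetti.map i q (singularCohomology.ringChange (algebraMap ℚ ℂ) _ q v) = 0
    rw [← ringChange_map (AlgPoints.mapContinuous (L := ℂ) i) v, hQ v, map_zero]
    intro j
    exact (Submodule.mem_iInf _).1 hv j
  exact hle key

/-- **From `x'|_{Z(ℂ)} = 0` to vanishing near `Z(ℂ)`** (tautness): for a closed immersion
`i : Z ↪ X` into a smooth projective `X` with `{P | pt P ∈ i(Z)}` locally contractible, a class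
`x' ∈ H^q(X(ℂ); ℂ)` with `i(ℂ)^* x' = 0` vanishes on an open neighbourhood of
`{P | pt P ∈ i(Z)} = i(ℂ)(Z(ℂ))` (`i(ℂ)` is an embedding onto it; Spanier, Ch. 6 §1 Thm. 10, the
tree's `exists_isOpen_map_subsetIncl_eq_zero_of_locallyContractibleSpace`).
[cite: Spanier1981, Ch. 6 §1, Thm. 10] -/
theorem exists_isOpen_map_subsetIncl_eq_zero_of_complexBetti_map_eq_zero
    (hX : IsSmoothProjective n X) {Z : Motives.SchemeOver ℂ} (i : Z ⟶ X) [IsClosedImmersion i.left]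
    (hLC : LocallyContractibleSpace ↥({P : ComplexPoints X | P.pt ∈ Set.range i.left.base}))
    {q : ℕ} (x' : complexBetti X q) (hx' : complexBetti.map i q x' = 0) :
    ∃ V : Set (ComplexPoints X), IsOpen V ∧
      {P | P.pt ∈ Set.range i.left.base} ⊆ V ∧ singularCohomology.map ℂ ℂ (subsetIncl V) q x' = 0 := by
  have hemb := AlgPoints.isEmbedding_map_of_isClosedImmersion (L := ℂ) i
  have hrange : Set.range (AlgPoints.map (L := ℂ) i) =
      {P : ComplexPoints X | P.pt ∈ Set.range i.left.base} :=
    range_map_eq_setOf_pt_mem_range (L := ℂ) i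
  let e : ComplexPoints Z ≃ₜ ↥({P : ComplexPoints X | P.pt ∈ Set.range i.left.base}) :=
    hemb.toHomeomorph.trans (Homeomorph.setCongr hrange)
  have hZ : IsClosed (Set.range i.left.base) := i.left.isClosedEmbedding.isClosed_range
  have hres : singularCohomology.map ℂ ℂ
      (subsetIncl {P : ComplexPoints X | P.pt ∈ Set.range i.left.base}) q x' = 0 := by
    have hinj : Function.Injective (singularCohomology.map ℂ ℂ
        (e : C(ComplexPoints Z, ↥({P : ComplexPoints X | P.pt ∈ Set.range i.left.base}))) q) :=
      ((forget (ModuleCat ℂ)).mapIso (singularCohomology.mapIso ℂ ℂ e q)).toEquiv.injective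
    apply hinj
    rw [map_zero, ← ModuleCat.comp_apply, ← singularCohomology.map_comp]
    have hc : (subsetIncl {P : ComplexPoints X | P.pt ∈ Set.range i.left.base}).comp
        (e : C(ComplexPoints Z, ↥({P : ComplexPoints X | P.pt ∈ Set.range i.left.base}))) =
        AlgPoints.mapContinuous (L := ℂ) i := by
      ext P
      rfl
    rw [hc]
    exact hx'
  letI := hX.chartedSpace
  haveI := ComplexPoints.compactSpace_of_isSmoothProjective hX
  haveI := ComplexPoints.t2Space_of_isSmoothProjective hX
  exact exists_isOpen_map_subsetIncl_eq_zero_of_locallyContractibleSpace (d := 2 * n)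
    (isClosed_setOf_pt_mem hZ) hLC x' hres

/-- **Deligne, *Théorie de Hodge III*, Cor. 8.2.8 on the tree's carriers, from mixed Hodge
structures with Prop. 8.2.5.** Let `M` be a package of mixed Hodge structures on the rational
cohomology of pairs of `ℂ`-varieties (`Motives.MixedHodgeStructureOfPair ℂ`: functorial, pure of
weight `n` on `Hⁿ` of smooth projective varieties — the content of the named fact
`MixedHodgeStructureOfPair.existsDeligne`, Hodge III 8.3.8–8.3.9 with 8.2.2). ASSUME for it
Deligne's Prop. 8.2.5 (`h825`): for `Z` a proper variety and `π j : Y j ⟶ Z` a finite, jointly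
surjective family from smooth projective varieties (`⊔ Y j → Z` "propre surjectif, avec `Y`
lisse"), the classes of `H^q(Z(ℂ); ℚ)` killed by every `(π j)^*` lie in `W_{q-1}` ("le quotient de
poids `n` de `Hⁿ(X, ℚ)` est l'image de `Hⁿ(X, ℚ)` dans `Hⁿ(Y, ℚ)`", with Thm. 8.2.4 (iii),
`W_n Hⁿ(X) = Hⁿ(X)` for `X` proper — this is NOT among the axioms of the package and needs
Deligne's construction by proper hypercoverings, (8.2.5.2)); and ASSUME the
local contractibility of the complex points over Zariski-closed subsets of smooth projective
varieties (`hLC`; complex algebraic sets are triangulable — Łojasiewicz 1964 — not in the tree).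
THEN the named fact `Deligne1974_ker_restrictCompl_eq_iSup_range_complexGysin` holds. Proof as
printed: Prop. 8.2.7 "les noyaux de `f^*` et de `(fπ)^*` sont égaux" for `⊔ Y j → Z ↪ X`
(`singularCohomology_map_rat_eq_zero_of_W`: purity of `H^q(X)`, 8.2.5, strictness), tensored with
`ℂ` (`complexBetti_map_eq_zero_of_rat`), read on the germ of `Z(ℂ)` by tautness
(`exists_isOpen_map_subsetIncl_eq_zero_of_complexBetti_map_eq_zero`), and transposed by Poincaré
duality (`Deligne1974_ker_restrictCompl_eq_iSup_range_complexGysin_of_pullback`). What this leaves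
of the discharge is exactly `M`, `h825` and `hLC`.
[cite: DeligneHodgeIII1974, Prop. 8.2.5, Prop. 8.2.7 and Cor. 8.2.8]
[cite: DeligneHodgeII1971, Thm. 2.3.5 (iii)] -/
theorem Deligne1974_ker_restrictCompl_eq_iSup_range_complexGysin_of_mixedHodgeStructure
    (M : MixedHodgeStructureOfPair ℂ)
    (h825 : ∀ ⦃Z : Motives.SchemeOver ℂ⦄, (SchemePair.ofScheme Z).IsVarietyPair → IsProper Z.hom →
      ∀ ⦃ι : Type⦄ [Finite ι] ⦃m : ι → ℕ⦄ ⦃Y : ι → Motives.SchemeOver ℂ⦄,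
        (∀ j, IsSmoothProjective (m j) (Y j)) → ∀ (π : ∀ j, Y j ⟶ Z),
        (⋃ j, Set.range (π j).left.base) = Set.univ →
        ∀ (q : ℕ) (y : (SchemePair.ofScheme Z).bettiCohomology q),
          (∀ j, SchemePair.bettiCohomology.map (SchemePair.Hom.ofScheme (π j)) q y = 0) →
            y ∈ (M.mhs (SchemePair.ofScheme Z) q).W ((q : ℤ) - 1))
    (hLC : ∀ ⦃n : ℕ⦄ ⦃X : Motives.SchemeOver ℂ⦄, IsSmoothProjective n X → ∀ ⦃S : Set X.left⦄,
      IsClosed S → LocallyContractibleSpace ↥({P : ComplexPoints X | P.pt ∈ S})) :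
    Deligne1974_ker_restrictCompl_eq_iSup_range_complexGysin := by
  refine Deligne1974_ker_restrictCompl_eq_iSup_range_complexGysin_of_pullback ?_
  intro n X hX ι _ m Y hY g q x' hx'
  obtain ⟨Z, i, hi, π, hπ, hrange⟩ := exists_closedSubscheme_factor hX hY g
  haveI := hi
  obtain ⟨hZv, hZp⟩ := isVarietyPair_and_isProper_of_isClosedImmersion hX i
  -- the family `π` is jointly surjective onto `Z`
  have hsurj : (⋃ j, Set.range (π j).left.base) = Set.univ := by
    refine Set.eq_univ_of_forall fun z ↦ ?_
    have hz : i.left.base z ∈ ⋃ j, Set.range (g j).left.base := hrange ▸ ⟨z, rfl⟩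
    obtain ⟨j, y, hy⟩ := Set.mem_iUnion.1 hz
    refine Set.mem_iUnion.2 ⟨j, y, i.left.isClosedEmbedding.injective ?_⟩
    change ((π j ≫ i).left).base y = i.left.base z
    rw [hπ j]
    exact hy
  have hQ : ∀ v : singularCohomology ℚ ℚ (ComplexPoints X) q,
      (∀ j, singularCohomology.map ℚ ℚ (AlgPoints.mapContinuous (L := ℂ) (g j)) q v = 0) →
        singularCohomology.map ℚ ℚ (AlgPoints.mapContinuous (L := ℂ) i) q v = 0 :=
    fun v hv ↦ singularCohomology_map_rat_eq_zero_of_W M hX g i π hπ q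
      (h825 hZv hZp hY π hsurj q) v hv
  have hvan := complexBetti_map_eq_zero_of_rat hX g i q hQ x' hx'
  obtain ⟨V, hVo, hKV, hV⟩ := exists_isOpen_map_subsetIncl_eq_zero_of_complexBetti_map_eq_zero
    hX i (hLC hX i.left.isClosedEmbedding.isClosed_range) x' hvan
  refine ⟨V, hVo, ?_, hV⟩
  rw [← hrange]
  exact hKV

end Assembly

end HodgeTheory

end Literature.AlgebraicGeometry.HodgeTheory

end
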